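/-
Origin: expansion seat `planner-pub-hodgecm-toy2-g6-0`, handover #5 2026-08-18T11:29:57Z (ab91f673 171 l.; RUN 29 additive leaf; tree imports only, no rewrite) (`HOME/pub-hodgecm-toy2-g6/lean/Toy2g6/IndependenceLedger.lean`, md5 ab91f673, 171 lines);
landed by the gen-8 packager in gate run 29 as `HodgeCM/Model/Toy/IndependenceLedger.lean` (verbatim).
-/
/-
Copyright: pub-hodgecm cell (HodgeCMPerL). Consistency-witness layer (part (6a)(ii)); FACTS.md §1c, column P5 — ONE-NAME LEDGER.
Origin: HOME/pub-hodgecm-toy2-g6/lean/Toy2g6/IndependenceLedger.lean (WIP module `Toy2g6.IndependenceLedger`; intended final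
place `HodgeCM/Model/Toy/IndependenceLedger.lean` = module `HodgeCM.Model.Toy.IndependenceLedger`, CONTRIBUTING §3 kind L5)
(seat planner-pub-hodgecm-toy2-g6-0, CONSISTENCY seat 2, generation 6).
WIP imports to rewrite on landing: none (tree imports only; all of them landed in gate runs ≤ 28).
-/
import Summits.HodgeConjecture.HodgeCM.Model.Toy.ToyConjTwist
import Summits.HodgeConjecture.HodgeCM.Model.Toy.ToyPadH6
import Summits.HodgeConjecture.HodgeCM.Model.Toy.ToyPadH0Two
import Summits.HodgeConjecture.HodgeCM.Model.Toy.ToyPadH0J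
import Summits.HodgeConjecture.HodgeCM.Model.Toy.TruncAlgMilne
import Summits.HodgeConjecture.HodgeCM.Model.Toy.ToyCupScale
import Summits.HodgeConjecture.HodgeCM.Model.Toy.ToyCurveTrace
import Summits.HodgeConjecture.HodgeCM.Model.Toy.ToyPadH0FundDescent
import Summits.HodgeConjecture.HodgeCM.Model.Toy.CMInflationIndependentAll
import Summits.HodgeConjecture.HodgeCM.Model.Toy.ToyDimBump_2
import Summits.HodgeConjecture.HodgeCM.Model.Toy.KillH0
import Summits.HodgeConjecture.HodgeCM.Model.Toy.ToyFFacts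
import Summits.HodgeConjecture.HodgeCM.Model.Toy.ToyTrTop

/-!
# The independence ledger of the candidate model facts (FACTS.md §1c, column P5) — one audit name per claim

`HOME/FACTS.md` §1c lists, BY NAME, the candidate model facts of the Pohlmann / [QW8] side: statements about the
posited `Universe` that are true of smooth projective varieties (each with a page-checked reference in its docstring)
but are NOT among the model axioms M1–M28 (`Universe.ModelAxioms`).  Column P5 of that table asks, per row, for a
kernel witness that the row CARRIES CONTENT: a structure satisfying M1–M28 (and as much of the rest of the ledger as
the construction allows) in which the row FAILS.  Those witnesses were built one file at a time (gens 2–6 of the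
consistency seat, the node provers 04, the qw8/pohl lineages).  This file only COLLECTS them under four names, in the
weakest uniform shape, so that the article can cite the whole column at once; the per-row theorems named in the
docstrings are strictly stronger (they keep long lists of the OTHER facts true in the separating model).

* `LedgerFacts U` — the fifteen rows that hold in the exterior toy model, as one predicate:
  N1 `Fact_cupExterior`, N2 `Fact_cup_hodge`, N3 `Fact_pull_H0`, N4 `Fact_hodge_F0`, F2 = M35 `Fact_factorActDescends`,
  F4 = M36 `Fact_cupAlg`, F5 = M37 `Fact_cupAssoc`, F7 = M39 `Fact_gysin`, F7d = M41 `Fact_gysinDescent`,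
  F7d-B `Fact_gysinDescentB`, F-H0 = M43 `Fact_unitH0`, N5 `Fact_fundClass`, M38 `Fact_cmInflation`, D = M40 `Fact_dimProd`,
  H0 = M42 `Fact_H0_rank`.
* `ledgerFacts_consistent : ∃ U, U.ModelAxioms ∧ LedgerFacts U` — JOINT consistency (the exterior toy model `toyModel`).
* `ledgerFacts_independent` — for each of the fourteen rows other than F2: `∃ U, U.ModelAxioms ∧ ¬ (row)`.  Together
  with `ledgerFacts_consistent`: each of these rows is INDEPENDENT of M1–M28.
* `offLedger_refutable : ∃ U, U.ModelAxioms ∧ LedgerFacts U ∧ ¬ F6 ∧ ¬ T ∧ ¬ T-CM` — the three rows that FAIL in the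
  exterior toy model (F6 `Fact_weightDual`, T `Fact_trTop`, T-CM `Fact_trTopCM`) are not consequences of M1–M28 together
  with all fifteen ledger facts.
* F2 is the one row WITHOUT a separating model, and none is expected: F2 is a THEOREM of M1–M3, M18, M21, N1, N3 and
  the existence of sections of the product projections (`Universe.fact_factorActDescends_of_prodSection`,
  `Proofs/Pohlmann/FactorActDescent.lean`, class-M candidate `Universe.Fact_prodSection`), and every model in this package
  has such sections.

Separating models, by row (the stronger per-row theorems): N1 `padModel` (`fact_cupExterior_independent`, ToyPadH6);
N2 `twistModel` (`fact_cup_hodge_independent`, ToyConjTwist); N3 `twoPadModel` (`fact_pull_H0_independent`, ToyPadH0Two);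
N4 `jPadModel` (`fact_hodge_F0_independent`, ToyPadH0J); F4 `truncModel` (`fact_cupAlg_independent`, TruncAlgMilne);
F5 `cupModel` (`fact_cupAssoc_independent`, ToyCupScale); F7 `curveFlat` (`fact_gysin_independent`, ToyCurveTrace);
F7d / F7d-B / F-H0 / N5 `h0PadModel` (`fact_gysinDescent_independent`, `fact_gysinDescentB_independent`,
`fact_unitH0_independent`, ToyPadH0FundDescent; `fact_fundClass_independent`, ToyPadH0Fund); M38 `tagModel exteriorHodgeData`
(`cmInflation_independent_all`, CMInflationIndependentAll); D `bumpModel` (`fact_dimProd_independent`, ToyDimBump); H0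
`toyModel.killH0` (`degreeZero_independent`, KillH0); F6 / T / T-CM fail in `toyModel` itself (`not_fact_weightDual`,
`not_fact_trTop`, `not_fact_trTopCM`, ToyFFacts / ToyTrTop).

The OPEN INPUTS of the reduction (not facts: `RealisationExistsPerL`, `RealisationExistsFace`, `PohlmannSpan`,
`Qw8Sufficiency`, and `HC_CM`, `PerL`, `PeriodThmF` themselves) have their one-name independence statements already:
`openInputs_fieldwise_independent` (ToyOpenInputsFieldwise), `perL_independent` / `periodThmF_independent` /
`realisationExistsPerL_independent` / `realisationExistsFace_independent` (ToyOpenInputs), `hc_cm_independent_of_modelAxioms`,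
`qw8Sufficiency_independent`, `faceReduction_independent` (ToyTruncAlg), `pohlmannSpan_independent_of_rest` (ToyPadH6Alg).

All closures print `[propext, Classical.choice, Quot.sound]`.
-/

noncomputable section

namespace HodgeCM

namespace Toy

/-- The fifteen candidate model facts of `HOME/FACTS.md` §1c that hold in the exterior toy model, in the order
N1, N2, N3, N4, F2, F4, F5, F7, F7d, F7d-B, F-H0, N5, M38, D, H0. -/
def LedgerFacts (U : Universe) : Prop :=
  U.Fact_cupExterior ∧ U.Fact_cup_hodge ∧ U.Fact_pull_H0 ∧ U.Fact_hodge_F0 ∧ U.Fact_factorActDescends ∧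
    U.Fact_cupAlg ∧ U.Fact_cupAssoc ∧ U.Fact_gysin ∧ U.Fact_gysinDescent ∧ U.Fact_gysinDescentB ∧ U.Fact_unitH0 ∧
    U.Fact_fundClass ∧ U.Fact_cmInflation ∧ U.Fact_dimProd ∧ U.Fact_H0_rank

/-- The exterior toy model satisfies all fifteen ledger facts. -/
theorem toyModel_ledgerFacts : LedgerFacts toyModel :=
  ⟨toyModel_fact_cupExterior, toyModel_fact_cup_hodge, toyModel_fact_pull_H0, toyModel_fact_hodge_F0,
    fact_factorActDescends exteriorHodgeData, fact_cupAlg, fact_cupAssoc exteriorHodgeData, toyModel_fact_gysin,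
    toyModel_fact_gysinDescent, toyModel_fact_gysinDescentB, toyModel_fact_unitH0, toyModel_fact_fundClass,
    fact_cmInflation exteriorHodgeData, toyModel_fact_dimProd, toyModel_fact_H0_rank⟩

/-- **Joint consistency of the ledger**: some structure satisfies M1–M28 and all fifteen ledger facts. -/
theorem ledgerFacts_consistent : ∃ U : Universe, U.ModelAxioms ∧ LedgerFacts U :=
  ⟨toyModel, toyModel_modelAxioms, toyModel_ledgerFacts⟩

/-- **Each ledger fact other than F2 fails in some model of M1–M28** (the separating models of the module docstring, in the
order N1, N2, N3, N4, F4, F5, F7, F7d, F7d-B, F-H0, N5, M38, D, H0).  With `ledgerFacts_consistent`: each of these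
fourteen rows is independent of the model axioms.  (F2 is derivable: see the module docstring.) -/
theorem ledgerFacts_independent :
    (∃ U : Universe, U.ModelAxioms ∧ ¬ U.Fact_cupExterior) ∧
    (∃ U : Universe, U.ModelAxioms ∧ ¬ U.Fact_cup_hodge) ∧
    (∃ U : Universe, U.ModelAxioms ∧ ¬ U.Fact_pull_H0) ∧
    (∃ U : Universe, U.ModelAxioms ∧ ¬ U.Fact_hodge_F0) ∧
    (∃ U : Universe, U.ModelAxioms ∧ ¬ U.Fact_cupAlg) ∧
    (∃ U : Universe, U.ModelAxioms ∧ ¬ U.Fact_cupAssoc) ∧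
    (∃ U : Universe, U.ModelAxioms ∧ ¬ U.Fact_gysin) ∧
    (∃ U : Universe, U.ModelAxioms ∧ ¬ U.Fact_gysinDescent) ∧
    (∃ U : Universe, U.ModelAxioms ∧ ¬ U.Fact_gysinDescentB) ∧
    (∃ U : Universe, U.ModelAxioms ∧ ¬ U.Fact_unitH0) ∧
    (∃ U : Universe, U.ModelAxioms ∧ ¬ U.Fact_fundClass) ∧
    (∃ U : Universe, U.ModelAxioms ∧ ¬ U.Fact_cmInflation) ∧
    (∃ U : Universe, U.ModelAxioms ∧ ¬ U.Fact_dimProd) ∧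
    (∃ U : Universe, U.ModelAxioms ∧ ¬ U.Fact_H0_rank) := by
  refine ⟨?_, ?_, ?_, ?_, ?_, ?_, ?_, ?_, ?_, ?_, ?_, ?_, ?_, ?_⟩
  · obtain ⟨U, hM, -, -, -, h⟩ := fact_cupExterior_independent.2
    exact ⟨U, hM, h⟩
  · obtain ⟨U, hC, h⟩ := fact_cup_hodge_independent.2
    exact ⟨U, hC.1, h⟩
  · obtain ⟨U, hC, h⟩ := fact_pull_H0_independent.2
    exact ⟨U, hC.1, h⟩
  · obtain ⟨U, hC, h⟩ := fact_hodge_F0_independent.2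
    exact ⟨U, hC.1, h⟩
  · obtain ⟨U, hM, -, -, -, -, -, -, -, h⟩ := fact_cupAlg_independent.2
    exact ⟨U, hM, h⟩
  · obtain ⟨U, hC, h⟩ := fact_cupAssoc_independent.2
    exact ⟨U, hC.1, h⟩
  · obtain ⟨U, hC, h⟩ := fact_gysin_independent.2
    exact ⟨U, hC.1, h⟩
  · obtain ⟨U, hC, -, h⟩ := fact_gysinDescent_independent.2
    exact ⟨U, hC.1, h⟩
  · obtain ⟨U, hC, -, h⟩ := fact_gysinDescentB_independent.2
    exact ⟨U, hC.1, h⟩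
  · obtain ⟨U, hC, -, h⟩ := fact_unitH0_independent.2
    exact ⟨U, hC.1, h⟩
  · obtain ⟨U, hC, h⟩ := fact_fundClass_independent.2
    exact ⟨U, hC.1, h⟩
  · obtain ⟨U, hC, h⟩ := cmInflation_independent_all
    exact ⟨U, hC.1, h⟩
  · obtain ⟨U, hC, h⟩ := fact_dimProd_independent.2
    exact ⟨U, hC.1, h⟩
  · obtain ⟨U, hC, -, hneg, -⟩ := degreeZero_independent
    exact ⟨U, hC.1, hneg.1⟩

/-- **The three off-ledger rows are refutable**: the exterior toy model satisfies M1–M28 and all fifteen ledger facts,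
and refutes F6 `Fact_weightDual`, T `Fact_trTop` and T-CM `Fact_trTopCM`.  (No model of M1–M28 in which F6, T or T-CM
HOLDS is built in this package: they need padded objects, ToyFFacts / ToyTrTop module docstrings.) -/
theorem offLedger_refutable :
    ∃ U : Universe, U.ModelAxioms ∧ LedgerFacts U ∧ ¬ U.Fact_weightDual ∧ ¬ U.Fact_trTop ∧ ¬ U.Fact_trTopCM :=
  ⟨toyModel, toyModel_modelAxioms, toyModel_ledgerFacts, not_fact_weightDual exteriorHodgeData,
    not_fact_trTop exteriorHodgeData, not_fact_trTopCM exteriorHodgeData⟩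

/-- Pointwise form: no row of the ledger other than F2, and none of F6, T, T-CM, is a consequence of M1–M28. -/
theorem not_derivable_of_modelAxioms :
    (¬ ∀ U : Universe, U.ModelAxioms → U.Fact_cupExterior) ∧ (¬ ∀ U : Universe, U.ModelAxioms → U.Fact_cup_hodge) ∧
    (¬ ∀ U : Universe, U.ModelAxioms → U.Fact_pull_H0) ∧ (¬ ∀ U : Universe, U.ModelAxioms → U.Fact_hodge_F0) ∧
    (¬ ∀ U : Universe, U.ModelAxioms → U.Fact_cupAlg) ∧ (¬ ∀ U : Universe, U.ModelAxioms → U.Fact_cupAssoc) ∧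
    (¬ ∀ U : Universe, U.ModelAxioms → U.Fact_gysin) ∧ (¬ ∀ U : Universe, U.ModelAxioms → U.Fact_gysinDescent) ∧
    (¬ ∀ U : Universe, U.ModelAxioms → U.Fact_gysinDescentB) ∧ (¬ ∀ U : Universe, U.ModelAxioms → U.Fact_unitH0) ∧
    (¬ ∀ U : Universe, U.ModelAxioms → U.Fact_fundClass) ∧ (¬ ∀ U : Universe, U.ModelAxioms → U.Fact_cmInflation) ∧
    (¬ ∀ U : Universe, U.ModelAxioms → U.Fact_dimProd) ∧ (¬ ∀ U : Universe, U.ModelAxioms → U.Fact_H0_rank) ∧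
    (¬ ∀ U : Universe, U.ModelAxioms → U.Fact_weightDual) ∧ (¬ ∀ U : Universe, U.ModelAxioms → U.Fact_trTop) ∧
    (¬ ∀ U : Universe, U.ModelAxioms → U.Fact_trTopCM) := by
  obtain ⟨h1, h2, h3, h4, h5, h6, h7, h8, h9, h10, h11, h12, h13, h14⟩ := ledgerFacts_independent
  obtain ⟨U, hM, -, hF6, hT, hTCM⟩ := offLedger_refutable
  have neg : ∀ {P : Universe → Prop}, (∃ U : Universe, U.ModelAxioms ∧ ¬ P U) → ¬ ∀ U : Universe, U.ModelAxioms → P U :=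
    fun ⟨U, hM, h⟩ hall => h (hall U hM)
  exact ⟨neg h1, neg h2, neg h3, neg h4, neg h5, neg h6, neg h7, neg h8, neg h9, neg h10, neg h11, neg h12, neg h13, neg h14,
    neg ⟨U, hM, hF6⟩, neg ⟨U, hM, hT⟩, neg ⟨U, hM, hTCM⟩⟩

end Toy

end HodgeCM

end
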